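import Summits.QuantumFields.BalabanUV.T4Continuum.Support.B13TermHistSecantWitness
import Summits.QuantumFields.BalabanUV.T4Continuum.Support.B13TermHistEnvelope

/-!
# NE5 ∕ U3 — O2-hist, CAUCHY face: NON-VACUITY WITNESS for the activity-level producer
# `B13TermHistEnvelope.histFibreEnvelopeCl_b13_of_actBound` (one-polymer Ursell family `exp(o + h)`, BASED toy model with slack)

Cell `pub-balaban`, unit `b2b-balaban-t4-ne5-formalise-leaf-03` (NE5 formalisation swarm, LEAF PROVER 03, gen 3; companion of the
lineage's `Support/B13TermHistEnvelope.lean` p210127 and twin of `Support/B13TermHistSecantWitness.lean` p210325, which witnesses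
the SECANT face).  Summits-side bookkeeping under the LEAN PLACEMENT RULE.  A TOY — nothing of [Balaban1988RG2Cluster] is
modelled.  HONEST FRAMING: rung (B)+1 of the FINITE-VOLUME T⁴ programme — NOT infinite volume, NOT a mass gap, NOT the Clay problem,
NOT NE5 (NOT PRINTED; GAPS G-t4-U3-1).  HONEST DEPENDENCY (cell line, verbatim): continuum YM on T⁴ ⇐ BetaPertH ∧ nine spine estimates
(0/9 proved); BetaPertH ⇐ (D1) ∧ (D4) ∧ CAP+tail; G-an2-4 gates asym, D1 and NE2/3/4.

WHY A SECOND TOY.  The Cauchy face carries the SLACK binder `BoxInClass M K W` (around every BASE point the two-margin box lies in the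
class) which the secant face does not; the secant witness's `toyModel` has `Base := univ`, so its boxes are not contained in any
bounded class and `BoxInClass` FAILS for it.  The BASED toy `boxModel` below has the same output (`out oneIndexing topInc toyAct`,
leaf-08's `exp(o + h)` against a Dirac mass), unit margins, and `Base := B̄(0,1) × B̄(0,1)`; with the class `boxClass := B̄(0,2) × B̄(0,2)`
EVERY hypothesis of `histFibreEnvelopeCl_b13_of_actBound` holds with explicit data: slack by the triangle inequality
(`box_boxInClass`), structure (`box_actExpLinearOn`), activity NORM majorant `A ≡ e⁴` on the class (`box_normMajorant`), per-domain
budget `Summable` + `∑' = e⁴ ≤ e⁴·e^{−0·d}` (`box_budget`) — so **`toy_histFibreEnvelopeCl : HistFibreEnvelopeCl boxModel univ 0 (e⁴)`**,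
and the conclusion READ BACK (`toy_reading`) is the genuinely analytic statement «for ‖o₀‖, ‖h‖ ≤ 1, ‖o − o₀‖ ≤ 1, ‖v‖ ≤ 1 the map
ζ ↦ e^{o + (h + ζv)} is `DiffContOnCl` on the unit disc with sup ≤ e⁴ on the closed disc» — the producer is not circular and its
binder list (slack included) is jointly satisfiable.  0 sorry; axioms ⊆ {propext, Classical.choice, Quot.sound}.
-/

noncomputable section

open MeasureTheory Metric Set
open scoped BigOperators

namespace Summit.QuantumFields.BalabanUV.T4Continuum.B13TermHistEnvelopeWitness

open Literature.MathematicalPhysics.QuantumFieldTheory.Balaban1983to89.T4OutputRate (Carriers)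
open Literature.MathematicalPhysics.QuantumFieldTheory.Balaban1983to89.T4InputCauchyRate (toyCarriers)
open Literature.MathematicalPhysics.QuantumFieldTheory.Balaban1983to89.T4InputCauchyRateData (StepModel)
open Literature.MathematicalPhysics.QuantumFieldTheory.Balaban1983to89.T4InputCauchyRateSpecies (BoxInClass)
open Literature.MathematicalPhysics.QuantumFieldTheory.Balaban1983to89.T4InputCauchyRateTermwise (HistFibreEnvelopeCl)
open Summit.QuantumFields.BalabanUV.T4Continuum.B13StepTermFamily (ActExpLinearOn out out_eq_tsum toyAct toyData)
open Summit.QuantumFields.BalabanUV.T4Continuum.B13TermRep (actMajorant actMajorant_of_rel)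
open Summit.QuantumFields.BalabanUV.T4Continuum.B13TermHistSecantWitness (oneIndexing topInc coeff_one term_eq)
open Summit.QuantumFields.BalabanUV.T4Continuum.B13TermHistEnvelope (histFibreEnvelopeCl_b13_of_actBound)

/-- [folklore] The BASED toy step model: output = the one-polymer Ursell series of `exp(o + h)` (as the secant witness's `toyModel`);
base = the unit bi-ball `B̄(0,1) × B̄(0,1)`; unit margins; placeholder data maps (the Cauchy face reads `Out`, `Base`, `rOp`, `rHist`). -/
def boxModel : StepModel toyCarriers ℂ ℂ where
  Out := out oneIndexing topInc toyAct
  opA _ _ _ := 0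
  opB _ _ _ := 0
  insA _ _ _ _ := 0
  insB _ _ _ _ := 0
  Base _ _ _ := closedBall 0 1 ×ˢ closedBall 0 1
  rOp _ := 1
  rHist _ := 1
  rOp_pos _ := one_pos
  rHist_pos _ := one_pos

/-- [folklore] The roomy class of the based toy: `‖o‖ ≤ 2`, `‖h‖ ≤ 2` at every step (base radius 1 + margin 1). -/
def boxClass : ℕ → (ℕ → ℝ) → toyCarriers.BgB → Set (ℂ × ℂ) := fun _ _ _ => closedBall 0 2 ×ˢ closedBall 0 2

/-- [folklore] Membership in the roomy class, unfolded. -/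
theorem mem_boxClass {k : ℕ} {g : ℕ → ℝ} {U : toyCarriers.BgB} {q : ℂ × ℂ} (hq : q ∈ boxClass k g U) :
    ‖q.1‖ ≤ 2 ∧ ‖q.2‖ ≤ 2 := by
  obtain ⟨h1, h2⟩ := Set.mem_prod.1 hq
  exact ⟨mem_closedBall_zero_iff.1 h1, mem_closedBall_zero_iff.1 h2⟩

/-- [folklore] **SLACK HOLDS**: around every base point the unit two-margin box lies in the roomy class (triangle inequality). -/
theorem box_boxInClass : BoxInClass boxModel boxClass Set.univ := by
  intro k g _ U p hp q hq
  obtain ⟨hp1, hp2⟩ := Set.mem_prod.1 hp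
  obtain ⟨hq1, hq2⟩ := Set.mem_prod.1 hq
  rw [mem_closedBall_zero_iff] at hp1 hp2
  rw [mem_closedBall, dist_eq_norm] at hq1 hq2
  refine Set.mk_mem_prod (mem_closedBall_zero_iff.2 ?_) (mem_closedBall_zero_iff.2 ?_)
  · calc ‖q.1‖ = ‖(q.1 - p.1) + p.1‖ := by rw [sub_add_cancel]
      _ ≤ ‖q.1 - p.1‖ + ‖p.1‖ := norm_add_le _ _
      _ ≤ 1 + 1 := add_le_add hq1 hp1
      _ = 2 := by norm_num
  · calc ‖q.2‖ = ‖(q.2 - p.2) + p.2‖ := by rw [sub_add_cancel]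
      _ ≤ ‖q.2 - p.2‖ + ‖p.2‖ := norm_add_le _ _
      _ ≤ 1 + 1 := add_le_add hq2 hp2
      _ = 2 := by norm_num

/-- [folklore] The based toy's output IS `exp(o + h)` at step-`k` domains (one-term series, as `B13TermHistSecantWitness.out_eq`). -/
theorem out_eq {k : ℕ} {X : toyCarriers.Dom} (hX : toyCarriers.scale X = k) (o h : ℂ) :
    boxModel.Out k o h X = Complex.exp (o + h) := by
  show out oneIndexing topInc toyAct k o h X = _
  rw [out_eq_tsum, tsum_fintype, Fintype.sum_unique, term_eq hX]

/-- [folklore] STRUCTURE on the roomy class (the Dirac-mass exp-linear data of leaf-08; class-independent). -/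
theorem box_actExpLinearOn : ActExpLinearOn oneIndexing toyAct toyData boxClass Set.univ := by
  refine ⟨fun _ _ _ _ _ _ _ _ _ _ _ => ?_, fun _ _ _ _ q _ _ _ _ _ _ => ?_, fun _ _ _ _ _ _ _ _ _ _ _ _ => ?_,
    fun _ _ _ _ _ _ _ _ _ _ _ => ⟨1, ?_⟩, fun _ _ _ _ q _ _ _ _ _ _ => ?_⟩
  · show SigmaFinite (Measure.dirac ()); infer_instance
  · show Integrable (fun _ : Unit => Complex.exp q.1) (Measure.dirac ()); exact integrable_const _
  · exact aestronglyMeasurable_const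
  · exact Filter.Eventually.of_forall fun _ => by
      show ‖ContinuousLinearMap.id ℂ ℂ‖ ≤ 1
      exact ContinuousLinearMap.norm_id_le
  · show Complex.exp (q.1 + q.2) = ∫ _ : Unit, Complex.exp q.1 * Complex.exp (ContinuousLinearMap.id ℂ ℂ q.2)
      ∂(Measure.dirac ())
    rw [integral_dirac, ContinuousLinearMap.id_apply, Complex.exp_add]

/-- [folklore] ACTIVITY NORM MAJORANT on the roomy class: `‖exp(o + h)‖ = e^{Re(o+h)} ≤ e⁴` — the `hA` binder with `A ≡ e⁴`. -/
theorem box_normMajorant : ∀ k, ∀ g ∈ (Set.univ : Set (ℕ → ℝ)), ∀ (U : toyCarriers.BgB) (q : ℂ × ℂ), q ∈ boxClass k g U →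
    ∀ X : toyCarriers.Dom, toyCarriers.scale X = k → ∀ i, oneIndexing.Rel k i X →
      ∀ m, ‖toyAct (oneIndexing.poly i m) (oneIndexing.lab i m) q.1 q.2‖ ≤ (fun _ _ => Real.exp 4) (oneIndexing.poly i m)
        (oneIndexing.lab i m) := by
  intro k g _ U q hq X _ i _ m
  obtain ⟨ho, hh⟩ := mem_boxClass hq
  show ‖Complex.exp (q.1 + q.2)‖ ≤ Real.exp 4
  rw [Complex.norm_exp, Complex.add_re]
  exact Real.exp_le_exp.2 (by linarith [(Complex.re_le_norm q.1).trans ho, (Complex.re_le_norm q.2).trans hh])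

/-- [folklore] The induced combinatorial majorant is the constant `e⁴` at step-`k` domains. -/
theorem box_actMajorant {k : ℕ} {X : toyCarriers.Dom} (hX : toyCarriers.scale X = k) (i : Unit) :
    actMajorant oneIndexing topInc (fun _ _ => Real.exp 4) k X i = Real.exp 4 := by
  rw [actMajorant_of_rel (show oneIndexing.Rel k i X from hX), coeff_one, norm_one, one_mul]
  exact Fin.prod_univ_one _

/-- [folklore] PER-DOMAIN BUDGET at rate `0`: the one-point index is summable and `∑' = e⁴ ≤ e⁴·e^{−0·d(X)}` — the `hbud` binder. -/
theorem box_budget : ∀ k, ∀ g ∈ (Set.univ : Set (ℕ → ℝ)), ∀ (U : toyCarriers.BgB) (X : toyCarriers.Dom), toyCarriers.scale X = k →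
    Summable (actMajorant oneIndexing topInc ((fun (_ : ℕ) (_ : ℕ → ℝ) (_ : toyCarriers.BgB) (_ : Unit) (_ : Unit) => Real.exp 4) k g U) k X) ∧
      ∑' i, actMajorant oneIndexing topInc ((fun (_ : ℕ) (_ : ℕ → ℝ) (_ : toyCarriers.BgB) (_ : Unit) (_ : Unit) => Real.exp 4) k g U) k X i ≤
        Real.exp 4 * Real.exp (-(0 * toyCarriers.d X)) := by
  intro k g _ U X hX
  refine ⟨Summable.of_finite, ?_⟩
  rw [tsum_fintype, Fintype.sum_unique, box_actMajorant hX, zero_mul, neg_zero, Real.exp_zero, mul_one]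

/-- [folklore] **THE CAUCHY PRODUCER FIRES ON THE BASED TOY**: slack + structure + norm majorant `A ≡ e⁴` + per-domain budget `e⁴` at
rate `0` ⟹ `HistFibreEnvelopeCl boxModel univ 0 (e⁴)` — every binder of `histFibreEnvelopeCl_b13_of_actBound` discharged with
explicit data, the output identity by `rfl`. -/
theorem toy_histFibreEnvelopeCl : HistFibreEnvelopeCl boxModel Set.univ 0 (Real.exp 4) :=
  histFibreEnvelopeCl_b13_of_actBound oneIndexing topInc toyAct (M := boxModel) (D := toyData) (fun _ _ _ _ => rfl)
    box_boxInClass box_normMajorant box_budget box_actExpLinearOn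

/-- [folklore] **READING THE CONCLUSION** (non-triviality): for a base point `‖o₀‖, ‖h‖ ≤ 1`, an operator datum `‖o − o₀‖ ≤ 1` and a
history direction `‖v‖ ≤ 1`, the fibre map `ζ ↦ e^{o + (h + ζ•v)}` is complex-differentiable on the open unit disc, continuous up to
the boundary, and bounded by `e⁴` on the closed disc. -/
theorem toy_reading {o₀ o h v : ℂ} (ho₀ : ‖o₀‖ ≤ 1) (hh : ‖h‖ ≤ 1) (ho : ‖o - o₀‖ ≤ 1) (hv : ‖v‖ ≤ 1) :
    DiffContOnCl ℂ (fun ζ : ℂ => Complex.exp (o + (h + ζ • v))) (ball 0 1) ∧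
      ∀ ζ ∈ closedBall (0 : ℂ) 1, ‖Complex.exp (o + (h + ζ • v))‖ ≤ Real.exp 4 := by
  have hp : ((o₀, h) : ℂ × ℂ) ∈ boxModel.Base 0 (fun _ => 0) () :=
    Set.mk_mem_prod (mem_closedBall_zero_iff.2 ho₀) (mem_closedBall_zero_iff.2 hh)
  have hoB : o ∈ closedBall ((o₀, h) : ℂ × ℂ).1 (boxModel.rOp 0) := by
    rw [mem_closedBall, dist_eq_norm]; exact ho
  have key := toy_histFibreEnvelopeCl 0 (fun _ => 0) (Set.mem_univ _) () (o₀, h) hp (0 : ℕ) rfl o hoB v hv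
  have hd : toyCarriers.d (0 : ℕ) = 0 := rfl
  simp only [out_eq (k := 0) (X := (0 : ℕ)) rfl, hd, mul_zero, neg_zero, Real.exp_zero, mul_one] at key
  exact key

end Summit.QuantumFields.BalabanUV.T4Continuum.B13TermHistEnvelopeWitness

end
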